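import Summits.AtomisticToContinuum.Crystallization.Theorems.ChartedZeroExcessLayeredLatticeLiouvilleZZZYRD
import Summits.AtomisticToContinuum.Crystallization.Theorems.ChartedZeroExcessLayeredLatticeLiouvilleZZZYRCD

/-!
# Charted zero-excess layered-lattice Liouville — ZZZYRCE: the TailDebit door with a WORD-INDEXED Korn constant (device E″ of record)

Cell `decomp-a2c`, lens 2 «structural dichotomy (special | generic)», generation 99.  Critic r1798 admitted the device E″ — read the Korn constant of
each state from ITS OWN cells — for whichever closure line wins: census CSTATE54 measured the cell constant `c(s) ∈ [8.00, 8.99]` over all 735 JS53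
shapes (regular `8`, uniform box value `10`), and the thin-corner margin re-read at `ĉK(s) = 1/c(s)` is `0.094–0.096` against `0.050–0.060` at the
uniform `1/10` (M-a / M-b).  This file types it, on top of NODE E (tree ZZZYRD (239)) and edition 3c (ZZZYRCD):

* (K♯-W) `UniformContactKornW s Λ c₀ ℓ₀ r₁ cKf` — contact Korn with a word-indexed constant `cKf L w'`; the uniform (K♯) is its constant case
  (`uniformContactKornW_of_uniform`) and it yields (K♯) at constant `0` (`uniformContactKornP_zero_of_kornW`, the shape the tree door consumes);
* (CC♯-W) `CellCertificateW s Λ c₀ ℓ₀ r₁ cf` — NODE E's cell certificate with a word-indexed cell constant `cf L w'` (the K-files read `c_β` per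
  box), and the GLUE «ElementKornW» `(CS♯) ∧ (NC♯) ∧ (CC♯-W cf) ⇒ (K♯-W cKf)` for every `0 ≤ cKf ≤ 1/cf` pointwise (NODE E's proof word by word);
* (JF♯-DW) `ClusterCertificateDebitW … cKf ΘR ΘN κ₁` — ZZZYRCD's debit certificate with the closure `2κ₁ ≤ μ·cKf L w' − ν` read per word, its
  constant case `clusterCertificateDebitW_of_uniform`, and the doors `signedShellBudgetP_of_clusterCertificateDebitW` /
  `uniformEquilStabilityAt_of_clusterCertificateDebitW` (PROVED): (RI♯) ∧ (K♯-W) ∧ (TL♯-D) ∧ (PF♯) ∧ (PF♯-D) ∧ (JF♯-DW) ∧ (CZ♯) ⇒ (U♯).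

Census format unchanged but for the last column: `margin_E″(s) = max_{λ,μ}[μ·ĉK(s) − ν_debit(s)]`, `ĉK(s) = 1/c_β` of the state's box.  Def +
theorem file (3 defs, 7 theorems); imports ZZZYRD (tree) and ZZZYRCD; no instance / notation / option; 0 sorry; no numeric record instance. [g99]
-/

open scoped BigOperators InnerProductSpace RealInnerProductSpace

namespace Summit.AtomisticToContinuum.Crystallization.Theorems.ChartedZeroExcessLayeredLatticeLiouville

open Summit.AtomisticToContinuum.Crystallization.Theorems.ChartedPlanarOrderRigidityDoor (E3)

/-! ### (K♯-W): contact Korn with a word-indexed constant -/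

/-- **(K♯-W) «UniformContactKornW s Λ c₀ ℓ₀ r₁ cKf»** — on every admissible word `(L, w')`, for every finitely supported `φ`,
`cKf L w'·N₁(φ) ≤ S₁(φ) ≤ N₁(φ)`: (K♯) with the Korn constant read off the word (device E″, critic r1798).  Why it might fail: as (K♯), box by box —
a box whose cells certify only `c_β > 1/cKf(box)`. [g99] -/
def UniformContactKornW (s Λ c₀ ℓ₀ r₁ : ℝ) (cKf : (E3 ≃L[ℝ] E3) → (ℤ → E3) → ℝ) : Prop :=
  ∀ a : ℝ, 0 < a → ∀ (L : E3 ≃L[ℝ] E3) (w' : ℤ → E3), IsAdmissibleWord a s Λ c₀ ℓ₀ L w' →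
    ∀ φ : Cell 2 → ℤ → E3, HasFiniteSupport φ →
      cKf L w' * contactForm r₁ (gen₁ L) (gen₂ L) w' φ ≤ stretchForm 0 r₁ (gen₁ L) (gen₂ L) w' φ ∧
        stretchForm 0 r₁ (gen₁ L) (gen₂ L) w' φ ≤ contactForm r₁ (gen₁ L) (gen₂ L) w' φ

/-- the uniform (K♯) is the constant case of (K♯-W). [g99] -/
theorem uniformContactKornW_of_uniform {s Λ c₀ ℓ₀ r₁ cK : ℝ} (hK : UniformContactKornP s Λ c₀ ℓ₀ r₁ cK) :
    UniformContactKornW s Λ c₀ ℓ₀ r₁ (fun _ _ => cK) :=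
  fun a ha L w' hA φ hφ => hK a ha L w' hA φ hφ

/-- (K♯-W) gives the uniform (K♯) at constant `0` — the Korn-free shape `0 ≤ S₁ ≤ N₁` the tree door `uniformEquilStabilityAt_of_rigiditySplit`
consumes when the budget sells no stretch. [g99] -/
theorem uniformContactKornP_zero_of_kornW {s Λ c₀ ℓ₀ r₁ : ℝ} {cKf : (E3 ≃L[ℝ] E3) → (ℤ → E3) → ℝ} (hK : UniformContactKornW s Λ c₀ ℓ₀ r₁ cKf) :
    UniformContactKornP s Λ c₀ ℓ₀ r₁ 0 := by
  intro a ha L w' hA φ hφ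
  obtain ⟨_, h2⟩ := hK a ha L w' hA φ hφ
  refine ⟨?_, h2⟩
  have h0 : 0 ≤ stretchForm 0 r₁ (gen₁ L) (gen₂ L) w' φ := stretchForm_nonneg _ _ _ _ _ _
  simpa using h0

/-! ### (CC♯-W): NODE E's cell certificate with a word-indexed cell constant, and the glue to (K♯-W) -/

/-- **(CC♯-W) «CellCertificateW s Λ c₀ ℓ₀ r₁ cf»** — NODE E's (CC♯) `CellCertificateP` with the cell constant `cf L w'` read off the word: for every
admissible word ONE multiplier `μ` makes every tetrahedral cell certificate `tetCert (cf L w') μ` and every octahedral `octCert (cf L w') μ`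
non-negative.  The K-files certify `c_β` per box of the cell-distortion class (CELLBOX: `c_β ≤ 10`, thin JS53 shapes `8.0–9.0`); the uniform
(CC♯ c) is the constant case.  Why it might fail: as (CC♯). [g99] -/
def CellCertificateW (s Λ c₀ ℓ₀ r₁ : ℝ) (cf : (E3 ≃L[ℝ] E3) → (ℤ → E3) → ℝ) : Prop :=
  ∀ a : ℝ, 0 < a → ∀ (L : E3 ≃L[ℝ] E3) (w' : ℤ → E3), IsAdmissibleWord a s Λ c₀ ℓ₀ L w' →
    ∃ μ : ℝ, ∀ φ : Cell 2 → ℤ → E3,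
      (∀ t ∈ tetCells r₁ (gen₁ L) (gen₂ L) w', 0 ≤ tetCert (cf L w') μ (gen₁ L) (gen₂ L) w' φ t) ∧
        ∀ o ∈ octCells r₁ (gen₁ L) (gen₂ L) w', 0 ≤ octCert (cf L w') μ (gen₁ L) (gen₂ L) w' φ o

/-- the uniform (CC♯ c) is the constant case of (CC♯-W). [g99] -/
theorem cellCertificateW_of_uniform {s Λ c₀ ℓ₀ r₁ c : ℝ} (hCC : CellCertificateP s Λ c₀ ℓ₀ r₁ c) :
    CellCertificateW s Λ c₀ ℓ₀ r₁ (fun _ _ => c) :=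
  fun a ha L w' hA => hCC a ha L w' hA

/-- ★★ **GLUE «ElementKornW» (PROVED): (CS♯) ∧ (NC♯) ∧ (CC♯-W cf) ⇒ (K♯-W cKf)** for every word-indexed `cKf` with `0 ≤ cKf L w'` and
`cKf L w'·cf L w' ≤ 1` on admissible words — NODE E's `uniformContactKornP_of_cellCertificate`, word by word. [g99] -/
theorem uniformContactKornW_of_cellCertificateW {s Λ c₀ ℓ₀ r₁ : ℝ} {cf cKf : (E3 ≃L[ℝ] E3) → (ℤ → E3) → ℝ}
    (hcK : ∀ a : ℝ, 0 < a → ∀ (L : E3 ≃L[ℝ] E3) (w' : ℤ → E3), IsAdmissibleWord a s Λ c₀ ℓ₀ L w' → 0 ≤ cKf L w')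
    (hc : ∀ a : ℝ, 0 < a → ∀ (L : E3 ≃L[ℝ] E3) (w' : ℤ → E3), IsAdmissibleWord a s Λ c₀ ℓ₀ L w' → cKf L w' * cf L w' ≤ 1)
    (hCS : CellSumP s Λ c₀ ℓ₀ r₁) (hNL : CellNullLagrangianP s Λ c₀ ℓ₀ r₁) (hCC : CellCertificateW s Λ c₀ ℓ₀ r₁ cf) :
    UniformContactKornW s Λ c₀ ℓ₀ r₁ cKf := by
  intro a ha L w' hA φ hφ
  obtain ⟨fS, fN, fL, gS, gN, gL, eS, eN, eS', eN'⟩ := hCS a ha L w' hA φ hφ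
  have e0 := hNL a ha L w' hA φ hφ
  obtain ⟨μ, hμ⟩ := hCC a ha L w' hA
  obtain ⟨htet, hoct⟩ := hμ φ
  have hS0 : 0 ≤ stretchForm 0 r₁ (gen₁ L) (gen₂ L) w' φ := stretchForm_nonneg _ _ _ _ _ _
  have h1 : 0 ≤ ∑ᶠ t : tetCells r₁ (gen₁ L) (gen₂ L) w', tetCert (cf L w') μ (gen₁ L) (gen₂ L) w' φ t :=
    finsum_nonneg fun t => htet t.1 t.2
  have h2 : 0 ≤ ∑ᶠ o : octCells r₁ (gen₁ L) (gen₂ L) w', octCert (cf L w') μ (gen₁ L) (gen₂ L) w' φ o :=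
    finsum_nonneg fun o => hoct o.1 o.2
  have e1 : ∑ᶠ t : tetCells r₁ (gen₁ L) (gen₂ L) w', tetCert (cf L w') μ (gen₁ L) (gen₂ L) w' φ t =
      (cf L w' * (24 * stretchForm 0 r₁ (gen₁ L) (gen₂ L) w' φ) - 24 * contactForm r₁ (gen₁ L) (gen₂ L) w' φ) / 6 -
        μ * ∑ᶠ t : tetCells r₁ (gen₁ L) (gen₂ L) w', tetNL (gen₁ L) (gen₂ L) w' φ t := by
    rw [← eS, ← eN]; exact finsum_cert_expand fS fN fL (cf L w') μ 6
  have e2 : ∑ᶠ o : octCells r₁ (gen₁ L) (gen₂ L) w', octCert (cf L w') μ (gen₁ L) (gen₂ L) w' φ o =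
      (cf L w' * (48 * stretchForm 0 r₁ (gen₁ L) (gen₂ L) w' φ) - 48 * contactForm r₁ (gen₁ L) (gen₂ L) w' φ) / 3 -
        μ * ∑ᶠ o : octCells r₁ (gen₁ L) (gen₂ L) w', octNLw (gen₁ L) (gen₂ L) w' φ o := by
    rw [← eS', ← eN']; exact finsum_cert_expand gS gN gL (cf L w') μ 3
  refine ⟨cell_arith h1 h2 e1 e2 e0 hS0 (hcK a ha L w' hA) (hc a ha L w' hA), ?_⟩
  have hle : ∑ᶠ t : tetCells r₁ (gen₁ L) (gen₂ L) w', tetS (gen₁ L) (gen₂ L) w' φ t ≤ ∑ᶠ t : tetCells r₁ (gen₁ L) (gen₂ L) w', tetN φ t :=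
    finsum_le_finsum' fS fN fun t => tetS_le_tetN _ _ _ _ _
  rw [eS, eN] at hle
  linarith [hle]

/-! ### (JF♯-DW): the debit certificate with a word-indexed Korn constant, and the doors -/

/-- ★ **(JF♯-DW) «ClusterCertificateDebitW s Λ c₀ ℓ₀ r₁ ϱ R cKf ΘR ΘN κ₁»** — ZZZYRCD's (JF♯-D) with the closure read per word:
`2κ₁ ≤ μ·cKf L w' − ν` (crux, rank 3 · SPECIAL · INSTRUMENTED).  Census/K-file format: JS53 CERT-MODE minus the debit blocks, last column
`margin_E″(s) = max_{λ,μ}[μ·ĉK(s) − ν_debit]`, `ĉK(s) = 1/c_β(box)`.  Why it might fail: as (JF♯-D), with `+0.036` mean / `+0.04` thin-corner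
relief from E″ (M-a/M-b). [g99] -/
def ClusterCertificateDebitW (s Λ c₀ ℓ₀ r₁ ϱ R : ℝ) (cKf : (E3 ≃L[ℝ] E3) → (ℤ → E3) → ℝ)
    (ΘR ΘN : (E3 ≃L[ℝ] E3) → (ℤ → E3) → (Cell 2 × ℤ) × (Cell 2 × ℤ) → ℝ) (κ₁ : ℝ) : Prop :=
  ∀ a : ℝ, 0 < a → ∀ (L : E3 ≃L[ℝ] E3) (w' : ℤ → E3), IsAdmissibleWord a s Λ c₀ ℓ₀ L w' →
    ∃ (μ ν : ℝ) (d : ℤ → Cell 2) (Cpar : ℤ → Fin 3 → Fin 3 → (E3 →L[ℝ] E3)) (Cperp : Fin 3 → Fin 3 → (E3 →L[ℝ] E3)),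
      0 ≤ μ ∧ IsShortStep r₁ (gen₁ L) (gen₂ L) w' d ∧ 2 * κ₁ ≤ μ * cKf L w' - ν ∧
      ∀ (c : Cell 2 × ℤ) (φ : Cell 2 → ℤ → E3), HasFiniteSupport φ →
        clusterDebit ϱ R (ΘR L w') (ΘN L w') (gen₁ L) (gen₂ L) w' c φ ≤ clusterFormFull r₁ ϱ R μ ν d Cpar Cperp (gen₁ L) (gen₂ L) w' c φ

/-- the uniform-`cK` debit certificate (JF♯-D) is the constant case of (JF♯-DW). [g99] -/
theorem clusterCertificateDebitW_of_uniform {s Λ c₀ ℓ₀ r₁ ϱ R cK κ₁ : ℝ}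
    {ΘR ΘN : (E3 ≃L[ℝ] E3) → (ℤ → E3) → (Cell 2 × ℤ) × (Cell 2 × ℤ) → ℝ} (h : ClusterCertificateDebitP s Λ c₀ ℓ₀ r₁ ϱ R cK ΘR ΘN κ₁) :
    ClusterCertificateDebitW s Λ c₀ ℓ₀ r₁ ϱ R (fun _ _ => cK) ΘR ΘN κ₁ :=
  fun a ha L w' hA => h a ha L w' hA

/-- ★★ **GLUE «TailDebitW» (PROVED): (K♯-W cKf) ∧ (NL♯) ∧ (TL♯-D) ∧ (PF♯) ∧ (PF♯-D) ∧ (JF♯-DW cKf) ⇒ (SP♯) at Korn constant `0`** (the budget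
sells no stretch: `γS = 0`, `γN = κ₁`) for every window list — ZZZYRCD's arithmetic word by word with `cK ↦ cKf L w'`. [g99] -/
theorem signedShellBudgetP_of_clusterCertificateDebitW {s Λ c₀ ℓ₀ r₁ ϱ R κ₁ γT : ℝ} {cKf : (E3 ≃L[ℝ] E3) → (ℤ → E3) → ℝ}
    {ΘR ΘN : (E3 ≃L[ℝ] E3) → (ℤ → E3) → (Cell 2 × ℤ) × (Cell 2 × ℤ) → ℝ} {n : ℕ} {ρ C : ℕ → ℝ}
    (hK : UniformContactKornW s Λ c₀ ℓ₀ r₁ cKf) (hNL : NullLagrangianP) (hTD : TailDebitP s Λ c₀ ℓ₀ ϱ ΘR ΘN γT)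
    (hPU : PartitionIdentityFullP s Λ c₀ ℓ₀ r₁ ϱ R) (hPD : PartitionIdentityDebitP s Λ c₀ ℓ₀ ϱ R)
    (hJC : ClusterCertificateDebitW s Λ c₀ ℓ₀ r₁ ϱ R cKf ΘR ΘN κ₁) :
    SignedShellBudgetP s Λ c₀ ℓ₀ r₁ 0 κ₁ γT n ρ C := by
  intro a ha
  refine ⟨0, κ₁, fun _ => 0, fun _ => le_rfl, ?_, ?_, ?_⟩
  · simp
  · simp
  intro L w' hadm φ hφ E hE
  obtain ⟨μ, ν, d, Cpar, Cperp, hμ, hd, hc, hcl⟩ := hJC a ha L w' hadm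
  have h1 := hTD a ha L w' hadm φ hφ E hE
  have h2 := hPU a ha L w' hadm φ hφ μ ν d Cpar Cperp hd
  have h3 := hPD a ha L w' hadm φ hφ (ΘR L w') (ΘN L w')
  have h0 : nullTotal d Cpar Cperp φ = 0 := hNL d Cpar Cperp φ hφ
  have hcert' : 0 ≤ rangeHessSum ϱ (gen₁ L) (gen₂ L) w' φ
      - μ * stretchForm 0 r₁ (gen₁ L) (gen₂ L) w' φ + ν * contactForm r₁ (gen₁ L) (gen₂ L) w' φ + nullTotal d Cpar Cperp φ
      - debitForm ϱ (ΘR L w') (ΘN L w') (gen₁ L) (gen₂ L) w' φ :=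
    HasSum.nonneg (fun c => sub_nonneg.mpr (hcl c φ hφ)) (h2.sub h3)
  have hcert : 0 ≤ (rangeHessSum ϱ (gen₁ L) (gen₂ L) w' φ - debitForm ϱ (ΘR L w') (ΘN L w') (gen₁ L) (gen₂ L) w' φ)
      - μ * stretchForm 0 r₁ (gen₁ L) (gen₂ L) w' φ + ν * contactForm r₁ (gen₁ L) (gen₂ L) w' φ := by linarith
  have h1' : (rangeHessSum ϱ (gen₁ L) (gen₂ L) w' φ - debitForm ϱ (ΘR L w') (ΘN L w') (gen₁ L) (gen₂ L) w' φ)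
      - 2 * 0 * contactForm r₁ (gen₁ L) (gen₂ L) w' φ - 2 * γT * nnFormZ φ ≤ E := by linarith
  have hc' : 2 * (κ₁ + 0) ≤ μ * cKf L w' - ν := by linarith
  obtain ⟨hK1, _⟩ := hK a ha L w' hadm φ hφ
  have hN : 0 ≤ contactForm r₁ (gen₁ L) (gen₂ L) w' φ := contactForm_nonneg _ _ _ _ _
  have hmain := certificateFull_arith h1' hcert hK1 hN hμ hc'
  simpa using hmain

/-- ★★ **THE DOOR OF RECORD FOR LINE (D) WITH DEVICE E″ (PROVED): (RI♯) ∧ (K♯-W) ∧ (TL♯-D) ∧ (PF♯) ∧ (PF♯-D) ∧ (JF♯-DW) ∧ (CZ♯) ⇒ (U♯)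
`UniformEquilStabilityAt s Λ κ₀ c₀`** for every `κ₀ ≤ κ₁·cZ − γT`, `0 ≤ κ₁`; (NL♯) is ZZZYRCN's theorem; the tree door is entered at Korn
constant `0` (`uniformContactKornP_zero_of_kornW`). [g99] -/
theorem uniformEquilStabilityAt_of_clusterCertificateDebitW {s Λ c₀ ℓ₀ r₁ ϱ R cZ κ₁ κ₀ γT : ℝ} {cKf : (E3 ≃L[ℝ] E3) → (ℤ → E3) → ℝ}
    {ΘR ΘN : (E3 ≃L[ℝ] E3) → (ℤ → E3) → (Cell 2 × ℤ) × (Cell 2 × ℤ) → ℝ}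
    (h0 : 0 ≤ κ₁) (hκ : κ₀ ≤ κ₁ * cZ - γT) (hRI : UniformReindexP s Λ c₀ ℓ₀) (hK : UniformContactKornW s Λ c₀ ℓ₀ r₁ cKf)
    (hTD : TailDebitP s Λ c₀ ℓ₀ ϱ ΘR ΘN γT) (hPU : PartitionIdentityFullP s Λ c₀ ℓ₀ r₁ ϱ R) (hPD : PartitionIdentityDebitP s Λ c₀ ℓ₀ ϱ R)
    (hJC : ClusterCertificateDebitW s Λ c₀ ℓ₀ r₁ ϱ R cKf ΘR ΘN κ₁) (hCZ : IndexCurrencyP s Λ c₀ ℓ₀ r₁ cZ) :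
    UniformEquilStabilityAt s Λ κ₀ c₀ :=
  uniformEquilStabilityAt_of_rigiditySplit (n := 0) (ρ := fun _ => 0) (C := fun _ => 0) h0 hκ hRI (uniformContactKornP_zero_of_kornW hK)
    (shellStretchDominationP_zero _ _ _ _ _ _ _) (signedShellBudgetP_of_clusterCertificateDebitW hK nullLagrangianP hTD hPU hPD hJC) hCZ

/-- ★★ **THE FULL CHAIN FOR LINE (D)+E″ (PROVED): (RI♯) ∧ (CS♯) ∧ (NC♯) ∧ (CC♯-W cf) ∧ (TL♯-D) ∧ (PF♯) ∧ (PF♯-D) ∧ (JF♯-DW 1/cf) ∧ (CZ♯) ⇒ (U♯)**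
with the Korn constant `cKf = 1/cf` read off the word's own cells (`0 < cf`). [g99] -/
theorem uniformEquilStabilityAt_of_cells_debit {s Λ c₀ ℓ₀ r₁ ϱ R cZ κ₁ κ₀ γT : ℝ} {cf : (E3 ≃L[ℝ] E3) → (ℤ → E3) → ℝ}
    {ΘR ΘN : (E3 ≃L[ℝ] E3) → (ℤ → E3) → (Cell 2 × ℤ) × (Cell 2 × ℤ) → ℝ}
    (h0 : 0 ≤ κ₁) (hκ : κ₀ ≤ κ₁ * cZ - γT) (hRI : UniformReindexP s Λ c₀ ℓ₀)
    (hcf : ∀ a : ℝ, 0 < a → ∀ (L : E3 ≃L[ℝ] E3) (w' : ℤ → E3), IsAdmissibleWord a s Λ c₀ ℓ₀ L w' → 0 < cf L w')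
    (hCS : CellSumP s Λ c₀ ℓ₀ r₁) (hNC : CellNullLagrangianP s Λ c₀ ℓ₀ r₁) (hCC : CellCertificateW s Λ c₀ ℓ₀ r₁ cf)
    (hTD : TailDebitP s Λ c₀ ℓ₀ ϱ ΘR ΘN γT) (hPU : PartitionIdentityFullP s Λ c₀ ℓ₀ r₁ ϱ R) (hPD : PartitionIdentityDebitP s Λ c₀ ℓ₀ ϱ R)
    (hJC : ClusterCertificateDebitW s Λ c₀ ℓ₀ r₁ ϱ R (fun L w' => 1 / cf L w') ΘR ΘN κ₁) (hCZ : IndexCurrencyP s Λ c₀ ℓ₀ r₁ cZ) :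
    UniformEquilStabilityAt s Λ κ₀ c₀ := by
  have hK : UniformContactKornW s Λ c₀ ℓ₀ r₁ (fun L w' => 1 / cf L w') :=
    uniformContactKornW_of_cellCertificateW (fun a ha L w' hA => by positivity [hcf a ha L w' hA])
      (fun a ha L w' hA => by rw [one_div, inv_mul_cancel₀ (hcf a ha L w' hA).ne']) hCS hNC hCC
  exact uniformEquilStabilityAt_of_clusterCertificateDebitW h0 hκ hRI hK hTD hPU hPD hJC hCZ

end Summit.AtomisticToContinuum.Crystallization.Theorems.ChartedZeroExcessLayeredLatticeLiouville
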